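import Literature.Geometry.Manifold.FlowPeriodFunction
import Literature.Geometry.Manifold.FlowTimeReparametrisation
import Mathlib.Algebra.Order.ToIntervalMod
import Mathlib.Geometry.Manifold.ContMDiff.NormedSpace
import Mathlib.Analysis.Normed.Module.FiniteDimension
import Literature.Geometry.Manifold.InverseFunctionTheorem
import HarnessLib

/-!
# A smooth family of closed orbits: compactness, open saturation, and the Dehn twist along it

General dynamics / differential topology (topic `Geometry/Manifold`), third file of the twist
package of the Dehn–Nielsen–Baer seat (`FlowTimeReparametrisation.lean`: `x ↦ θ(τ x, x)` is a
diffeomorphism for an invariant time `τ`; `FlowPeriodFunction.lean`: the period of a family of closed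
orbits parametrised by the first integrals `H` is a smooth germ `P`, and `P ∘ H` is a period on the
saturation `flowSaturation θ σ S = {θ(u, σ s)}`).  Here the local statements are globalised along
a whole family `σ : F → E` of periodic section points over an OPEN parameter set `J`
(`H (σ s) = s`, `θ(P s, σ s) = σ s`, `0 < P s`, `P` continuous on `J`), and the twist is assembled:

* §1 `apply_int_mul_period`, `exists_mem_Ico_apply_eq` — integer multiples of a period are periods;
  every point of a closed orbit is reached in time `∈ [0, P)`.
* §2 `isCompact_flowSaturation` — over a compact parameter set the saturation is compact (it is the
  image of `[0, max P] × K`).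
* §3 `mem_flowSaturation_of_mem_closure` — **the saturation over `J` is closed in `H⁻¹(J)`**
  (`F` locally compact): a limit of points of the family whose first integrals stay in `J` belongs
  to the family.
* §4 `isOpen_flowSaturation` — **the saturation over `J` is open** when `Λ(u, s) = θ(u, σ s)` has
  invertible differential along `ℝ × J` (inverse function theorem, `HasStrictFDerivAt.map_nhds_eq_of_equiv`);
  `exists_equiv_hasStrictFDerivAt_of_finrank` — for a complete set of smooth first integrals
  (`dim E = dim F + 1`) this holds wherever the velocity is non-zero (`dH` kills the velocity and
  `dH ∘ ∂ₛΛ = id`); `isOpen_flowSaturation_of_finrank`, and the planar case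
  `isOpen_flowSaturation_of_finrank_eq_two` (`dim E = 2`, `F = ℝ`).
* §5 `contDiff_twistTime` — **the cut-off time function** `τ = 𝟙_{Sat} · (μ ∘ H) · (P ∘ H)` (with
  `μ` smooth, vanishing off a closed set `C ⊆ J`, `P` smooth on `J`) **is smooth on all of `E`**,
  invariant (`twistTime_invariant`), and `θ(τ x, x) = x` off the saturation and wherever `μ(H x) = 1`
  (`apply_twistTime_eq_self`).
* §4b `exists_contDiffOn_period` — the period germ of `FlowPeriodFunction.lean` is smooth on a
  whole open neighbourhood (the local inverse is smooth on a shrunk target).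
* §7 `exists_period_package`, `exists_twistDiffeomorph` — **assembly**: near a closed orbit of
  positive period with non-vanishing velocity (complete smooth first integrals, `dim E = dim F + 1`)
  all the above hypotheses are met on some open `S ∋ s₀`, and for every smooth bump `μ` supported
  in a closed subset of `S` the Dehn twist along the family is a diffeomorphism `T` of `E` with
  `H ∘ T = H`, `T = id` off the family, `T x = θ(μ(H x)·P(H x), x)` on it.
* §6 `twistDiffeomorph` — **the Dehn twist along the family**: the diffeomorphism `x ↦ θ(τ x, x)` of
  `E` (`flowReparamDiffeomorph`); it preserves every first integral of the flow
  (`apply_twistDiffeomorph_of_invariant` — in the application, the level function of a regular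
  sublevel set of `ℝ³`, so that the twist restricts to the boundary surface), is the identity off the
  saturation (`twistDiffeomorph_apply_of_not_mem`) and is the identity on the part of the family
  where the bump is `1` (`twistDiffeomorph_apply_of_eq_one`) — Farb–Margalit's twist map
  `T(θ, t) = (θ + 2πt, t)`, identity near both boundary circles of the annulus up to a full turn.

Everything is proved; definitions: `twistTime`, `twistDiffeomorph`; no named facts (D-0026).

* `exists_minimal_period` — the periods of a moving point with some positive period are the integer
  multiples of a least positive period (closed subgroups of `ℝ` are dense or cyclic).

## References

* B. Farb, D. Margalit, *A primer on mapping class groups*, PMS 49 (2012), §3.1.1 (PDF p. 62).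
  [FarbMargalit2012]
* J. M. Lee, *Introduction to Smooth Manifolds*, 2nd ed., GTM 218 (2012), Thm. 9.12, Thm. C.34.
  [LeeSmoothManifolds2013]
-/

open scoped ContDiff Topology Manifold
open Set Function Filter

noncomputable section

namespace Literature.Geometry.Manifold

/-! ### §1 Integer multiples of a period; reduction of times to one period -/

section Periods

variable {E : Type*}

/-- Natural multiples of a period are periods. [folklore] -/
theorem apply_nat_mul_period {θ : ℝ × E → E} (h0 : ∀ x, θ (0, x) = x)
    (hadd : ∀ t s x, θ (t, θ (s, x)) = θ (t + s, x)) {T : ℝ} {x : E} (hx : θ (T, x) = x) (n : ℕ) :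
    θ (n * T, x) = x := by
  induction n with
  | zero => simp [h0]
  | succ n ih =>
    rw [Nat.cast_succ, add_mul, one_mul, ← hadd, hx, ih]

/-- Integer multiples of a period are periods. [folklore] -/
theorem apply_int_mul_period {θ : ℝ × E → E} (h0 : ∀ x, θ (0, x) = x)
    (hadd : ∀ t s x, θ (t, θ (s, x)) = θ (t + s, x)) {T : ℝ} {x : E} (hx : θ (T, x) = x) (n : ℤ) :
    θ (n * T, x) = x := by
  obtain ⟨m, rfl | rfl⟩ := Int.eq_nat_or_neg n
  · exact_mod_cast apply_nat_mul_period h0 hadd hx m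
  · have h := apply_nat_mul_period h0 hadd hx m
    calc θ (((-(m : ℤ) : ℤ) : ℝ) * T, x) = θ (-(m * T), θ (m * T, x)) := by rw [h]; push_cast; ring_nf
      _ = x := by rw [hadd, neg_add_cancel, h0]

/-- Shifting the time by an integer multiple of a period does not change the point. [folklore] -/
theorem apply_add_int_mul_period {θ : ℝ × E → E} (h0 : ∀ x, θ (0, x) = x)
    (hadd : ∀ t s x, θ (t, θ (s, x)) = θ (t + s, x)) {T : ℝ} {x : E} (hx : θ (T, x) = x)
    (u : ℝ) (n : ℤ) : θ (u + n * T, x) = θ (u, x) := by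
  rw [← hadd, apply_int_mul_period h0 hadd hx n]

/-- **Every point of a closed orbit is reached within one period**: for `0 < T` a period of `x`,
`θ(u, x) = θ(r, x)` for some `r ∈ [0, T)`. [folklore] -/
theorem exists_mem_Ico_apply_eq {θ : ℝ × E → E} (h0 : ∀ x, θ (0, x) = x)
    (hadd : ∀ t s x, θ (t, θ (s, x)) = θ (t + s, x)) {T : ℝ} (hT : 0 < T) {x : E}
    (hx : θ (T, x) = x) (u : ℝ) : ∃ r ∈ Ico 0 T, θ (u, x) = θ (r, x) := by
  refine ⟨toIcoMod hT 0 u, by simpa using toIcoMod_mem_Ico' hT u, ?_⟩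
  conv_lhs => rw [← toIcoMod_add_toIcoDiv_zsmul hT 0 u, zsmul_eq_mul]
  exact apply_add_int_mul_period h0 hadd hx _ _

end Periods

/-! ### §2 Compactness of the saturation over a compact parameter set -/

section SaturationAlgebra

variable {E : Type*} {F : Type*}

/-- With positive periods bounded by `M` on `S`, the saturation over `S` is the image of
`[0, M] × S`. [folklore] -/
theorem flowSaturation_eq_image_Icc {θ : ℝ × E → E} (h0 : ∀ x, θ (0, x) = x)
    (hadd : ∀ t s x, θ (t, θ (s, x)) = θ (t + s, x)) {σ : F → E} {S : Set F} {P : F → ℝ}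
    (hPpos : ∀ s ∈ S, 0 < P s) (hP : ∀ s ∈ S, θ (P s, σ s) = σ s) {M : ℝ} (hM : ∀ s ∈ S, P s ≤ M) :
    flowSaturation θ σ S = (fun p : ℝ × F => θ (p.1, σ p.2)) '' (Icc 0 M ×ˢ S) := by
  apply Subset.antisymm
  · intro x hx
    obtain ⟨u, s, hs, rfl⟩ := mem_flowSaturation_iff.1 hx
    obtain ⟨r, hr, hru⟩ := exists_mem_Ico_apply_eq h0 hadd (hPpos s hs) (hP s hs) u
    exact ⟨(r, s), ⟨⟨hr.1, hr.2.le.trans (hM s hs)⟩, hs⟩, hru.symm⟩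
  · rintro x ⟨⟨u, s⟩, ⟨-, hs⟩, rfl⟩
    exact mem_flowSaturation_iff.2 ⟨u, s, hs, rfl⟩

/-- The saturation is monotone in the parameter set. [folklore] -/
theorem flowSaturation_mono {θ : ℝ × E → E} {σ : F → E} {S S' : Set F} (h : S ⊆ S') :
    flowSaturation θ σ S ⊆ flowSaturation θ σ S' := fun x hx => by
  obtain ⟨u, s, hs, rfl⟩ := mem_flowSaturation_iff.1 hx
  exact mem_flowSaturation_iff.2 ⟨u, s, h hs, rfl⟩

end SaturationAlgebra

section Compact

variable {E : Type*} [TopologicalSpace E] {F : Type*} [TopologicalSpace F]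

/-- **Over a compact parameter set the saturation is compact** (continuous flow and section,
positive periods depending continuously on the parameter). [folklore] -/
theorem isCompact_flowSaturation {θ : ℝ × E → E} (hθc : Continuous θ) (h0 : ∀ x, θ (0, x) = x)
    (hadd : ∀ t s x, θ (t, θ (s, x)) = θ (t + s, x)) {σ : F → E} (hσc : Continuous σ)
    {K : Set F} (hK : IsCompact K) {P : F → ℝ} (hPc : ContinuousOn P K)
    (hPpos : ∀ s ∈ K, 0 < P s) (hP : ∀ s ∈ K, θ (P s, σ s) = σ s) :
    IsCompact (flowSaturation θ σ K) := by
  rcases K.eq_empty_or_nonempty with rfl | hne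
  · have : flowSaturation θ σ (∅ : Set F) = ∅ := by
      ext x; simp [mem_flowSaturation_iff]
    rw [this]; exact isCompact_empty
  obtain ⟨s₁, hs₁, hmax⟩ := hK.exists_isMaxOn hne hPc
  rw [flowSaturation_eq_image_Icc h0 hadd hPpos hP (M := P s₁) fun s hs => hmax hs]
  exact (isCompact_Icc.prod hK).image
    (hθc.comp (continuous_fst.prodMk (hσc.comp continuous_snd)))

end Compact

/-! ### §3 The saturation over an open parameter set is closed in `H⁻¹(J)` -/

section Closed

variable {E : Type*} [TopologicalSpace E] [T2Space E] {F : Type*} [TopologicalSpace F]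
  [LocallyCompactSpace F]

/-- **Relative closedness of the family**: if `x` is a limit of points of the saturation over the
open parameter set `J` and `H x ∈ J`, then `x` belongs to the saturation (the part of the family
over a compact neighbourhood of `H x` in `J` is compact). [folklore] -/
theorem mem_flowSaturation_of_mem_closure {θ : ℝ × E → E} (hθc : Continuous θ)
    (h0 : ∀ x, θ (0, x) = x) (hadd : ∀ t s x, θ (t, θ (s, x)) = θ (t + s, x))
    {H : E → F} (hHc : Continuous H) (hH : ∀ t x, H (θ (t, x)) = H x)
    {σ : F → E} (hσc : Continuous σ) {J : Set F} (hHσ : ∀ s ∈ J, H (σ s) = s)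
    {P : F → ℝ} (hPc : ContinuousOn P J) (hPpos : ∀ s ∈ J, 0 < P s) (hP : ∀ s ∈ J, θ (P s, σ s) = σ s)
    {x : E} (hx : x ∈ closure (flowSaturation θ σ J)) (hxJ : J ∈ 𝓝 (H x)) :
    x ∈ flowSaturation θ σ J := by
  -- a compact neighbourhood `K ⊆ J` of `H x`
  obtain ⟨K, hKc, hKx, hKJ⟩ := exists_compact_subset isOpen_interior (mem_interior_iff_mem_nhds.2 hxJ)
  have hKJ' : K ⊆ J := hKJ.trans interior_subset
  -- the open set `U = H⁻¹(interior K)` contains `x`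
  set U : Set E := H ⁻¹' interior K with hU
  have hUo : IsOpen U := isOpen_interior.preimage hHc
  have hxU : x ∈ U := hKx
  -- points of the family in `U` lie in the (compact) family over `K`
  have hsub : U ∩ flowSaturation θ σ J ⊆ flowSaturation θ σ K := by
    rintro y ⟨hyU, hy⟩
    obtain ⟨u, s, hs, rfl⟩ := mem_flowSaturation_iff.1 hy
    have hHs : H (θ (u, σ s)) = s := by rw [hH, hHσ s hs]
    have hsK : s ∈ K := by
      have : H (θ (u, σ s)) ∈ interior K := hyU
      rw [hHs] at this
      exact interior_subset this
    exact mem_flowSaturation_iff.2 ⟨u, s, hsK, rfl⟩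
  have hcpt : IsCompact (flowSaturation θ σ K) :=
    isCompact_flowSaturation hθc h0 hadd hσc hKc (hPc.mono hKJ') (fun s hs => hPpos s (hKJ' hs))
      fun s hs => hP s (hKJ' hs)
  have h1 : x ∈ closure (U ∩ flowSaturation θ σ J) := hUo.inter_closure ⟨hxU, hx⟩
  have h2 : closure (U ∩ flowSaturation θ σ J) ⊆ flowSaturation θ σ K :=
    closure_minimal hsub hcpt.isClosed
  exact flowSaturation_mono hKJ' (h2 h1)

end Closed


/-! ### §4 The saturation over an open parameter set is open -/

section Open

variable {E : Type*} [NormedAddCommGroup E] [NormedSpace ℝ E]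
  {F : Type*} [NormedAddCommGroup F] [NormedSpace ℝ F] [CompleteSpace F]

/-- **Openness of the family** from the inverse function theorem: if `Λ(u, s) = θ(u, σ s)` has an
invertible strict differential at every point of `ℝ × J`, `J` open, then the saturation over `J` is
open. [cite: LeeSmoothManifolds2013, Thm. C.34] -/
theorem isOpen_flowSaturation {θ : ℝ × E → E} {σ : F → E} {J : Set F} (hJ : IsOpen J)
    (hΛ : ∀ u : ℝ, ∀ s ∈ J, ∃ L : (ℝ × F) ≃L[ℝ] E,
      HasStrictFDerivAt (fun p : ℝ × F => θ (p.1, σ p.2)) (L : ℝ × F →L[ℝ] E) (u, s)) :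
    IsOpen (flowSaturation θ σ J) := by
  rw [isOpen_iff_mem_nhds]
  intro x hx
  obtain ⟨u, s, hs, rfl⟩ := mem_flowSaturation_iff.1 hx
  obtain ⟨L, hL⟩ := hΛ u s hs
  have hmap := hL.map_nhds_eq_of_equiv
  have hmem : (univ : Set ℝ) ×ˢ J ∈ 𝓝 (u, s) := prod_mem_nhds univ_mem (hJ.mem_nhds hs)
  have himg : (fun p : ℝ × F => θ (p.1, σ p.2)) '' ((univ : Set ℝ) ×ˢ J) ∈
      Filter.map (fun p : ℝ × F => θ (p.1, σ p.2)) (𝓝 (u, s)) := image_mem_map hmem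
  rw [hmap] at himg
  exact himg

omit [CompleteSpace F] in
/-- **Non-degeneracy at an arbitrary point of the family** when the first integrals form a
complete set (`dim E = dim F + 1`): for smooth `H : E → F` and a smooth section `σ` of `H` near `s`,
the differential of `Λ(t, s') = θ(t, σ s')` at `(u, s)` is invertible as soon as the velocity of
`t ↦ θ(t, σ s)` at `u` is non-zero — `dH` kills the velocity (invariance) and `dH ∘ ∂ₛΛ = id`
(`H ∘ σ = id`), so the differential is injective, and the dimensions agree.
[cite: LeeSmoothManifolds2013, Thm. C.34] -/
theorem exists_equiv_hasStrictFDerivAt_of_finrank [FiniteDimensional ℝ E] [FiniteDimensional ℝ F]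
    (hEF : Module.finrank ℝ E = Module.finrank ℝ F + 1)
    {θ : ℝ × E → E} (hθ : ContDiff ℝ ∞ θ) {H : E → F} (hHs : ContDiff ℝ ∞ H)
    (hH : ∀ t x, H (θ (t, x)) = H x)
    {σ : F → E} (hσ : ContDiff ℝ ∞ σ) {s : F} (hHσ : ∀ᶠ s' in 𝓝 s, H (σ s') = s') (u : ℝ)
    {v : E} (hv : HasDerivAt (fun t => θ (t, σ s)) v u) (hv0 : v ≠ 0) :
    ∃ L : (ℝ × F) ≃L[ℝ] E,
      HasStrictFDerivAt (fun p : ℝ × F => θ (p.1, σ p.2)) (L : ℝ × F →L[ℝ] E) (u, s) := by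
  set Λ : ℝ × F → E := fun p => θ (p.1, σ p.2) with hΛdef
  have hΛc : ContDiff ℝ ∞ Λ := hθ.comp (contDiff_fst.prodMk (hσ.comp contDiff_snd))
  have hΛs : HasStrictFDerivAt Λ (fderiv ℝ Λ (u, s)) (u, s) :=
    hΛc.contDiffAt.hasStrictFDerivAt (by simp)
  have hΛd : HasFDerivAt Λ (fderiv ℝ Λ (u, s)) (u, s) := hΛs.hasFDerivAt
  set L₀ : ℝ × F →L[ℝ] E := fderiv ℝ Λ (u, s) with hL₀
  have hHd : ∀ y, HasFDerivAt H (fderiv ℝ H y) y := fun y => ((hHs.differentiable (by simp)) y).hasFDerivAt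
  -- the time column: the velocity `v`
  have hcol1 : L₀ (1, 0) = v := by
    have hi : HasDerivAt (fun t : ℝ => ((t, s) : ℝ × F)) ((1, 0) : ℝ × F) u :=
      (hasDerivAt_id u).prodMk (hasDerivAt_const u s)
    have hc : HasDerivAt (Λ ∘ fun t : ℝ => ((t, s) : ℝ × F)) (L₀ (1, 0)) u := hΛd.comp_hasDerivAt u hi
    have hfun : (Λ ∘ fun t : ℝ => ((t, s) : ℝ × F)) = fun t => θ (t, σ s) := rfl
    rw [hfun] at hc
    exact hc.unique hv
  -- `dH(v) = 0` at the point `θ(u, σ s)`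
  have hdHv : fderiv ℝ H (θ (u, σ s)) v = 0 := by
    have hc : HasDerivAt (fun t : ℝ => H (θ (t, σ s))) (fderiv ℝ H (θ (u, σ s)) v) u :=
      (hHd (θ (u, σ s))).comp_hasDerivAt u hv
    have hconst : (fun t : ℝ => H (θ (t, σ s))) = fun _ => H (σ s) := funext fun t => hH t _
    rw [hconst] at hc
    exact hc.unique (hasDerivAt_const u _)
  -- `dH ∘ L₀ ∘ inr = id`: the section columns
  have hdHw : ∀ w : F, fderiv ℝ H (θ (u, σ s)) (L₀ (0, w)) = w := by
    have hi : HasFDerivAt (fun s' : F => ((u, s') : ℝ × F)) (ContinuousLinearMap.inr ℝ ℝ F) s :=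
      (hasFDerivAt_const u s).prodMk (hasFDerivAt_id s)
    have hc : HasFDerivAt (Λ ∘ fun s' : F => ((u, s') : ℝ × F))
        (L₀.comp (ContinuousLinearMap.inr ℝ ℝ F)) s := hΛd.comp s hi
    have hc' : HasFDerivAt (H ∘ (Λ ∘ fun s' : F => ((u, s') : ℝ × F)))
        ((fderiv ℝ H ((Λ ∘ fun s' : F => ((u, s') : ℝ × F)) s)).comp
          (L₀.comp (ContinuousLinearMap.inr ℝ ℝ F))) s :=
      (hHd _).comp s hc
    have heq : (H ∘ (Λ ∘ fun s' : F => ((u, s') : ℝ × F))) =ᶠ[𝓝 s] id := by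
      filter_upwards [hHσ] with s' hs'
      change H (θ (u, σ s')) = s'
      rw [hH, hs']
    have hid : HasFDerivAt (H ∘ (Λ ∘ fun s' : F => ((u, s') : ℝ × F))) (ContinuousLinearMap.id ℝ F) s :=
      (hasFDerivAt_id s).congr_of_eventuallyEq heq
    have hLeq := hc'.unique hid
    intro w
    have h := congrArg (fun T : F →L[ℝ] F => T w) hLeq
    simpa using h
  -- injectivity, hence invertibility by dimension
  have hinj : Injective (L₀ : ℝ × F →ₗ[ℝ] E) := by
    intro p q hpq
    have hlin : ∀ r : ℝ × F, L₀ r = r.1 • v + L₀ (0, r.2) := by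
      intro r
      have hr : r = r.1 • ((1, 0) : ℝ × F) + ((0, r.2) : ℝ × F) := by ext <;> simp
      conv_lhs => rw [hr]
      rw [map_add, map_smul, hcol1]
    have h : L₀ (p - q) = 0 := by rw [map_sub]; exact sub_eq_zero.2 hpq
    rw [hlin] at h
    have h2 : (p - q).2 = 0 := by
      have := congrArg (fderiv ℝ H (θ (u, σ s))) h
      rw [map_add, map_smul, hdHv, hdHw, map_zero, smul_zero, zero_add] at this
      exact this
    have h1 : (p - q).1 = 0 := by
      rw [h2, Prod.mk_zero_zero, map_zero, add_zero] at h
      exact (smul_eq_zero.1 h).resolve_right hv0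
    exact Prod.ext (sub_eq_zero.1 h1) (sub_eq_zero.1 h2)
  have hdim : Module.finrank ℝ (ℝ × F) = Module.finrank ℝ E := by
    rw [Module.finrank_prod, Module.finrank_self, hEF, add_comm]
  refine ⟨(LinearMap.linearEquivOfInjective (L₀ : ℝ × F →ₗ[ℝ] E) hinj hdim).toContinuousLinearEquiv, ?_⟩
  have hLeq : ((LinearMap.linearEquivOfInjective (L₀ : ℝ × F →ₗ[ℝ] E) hinj hdim).toContinuousLinearEquiv :
      ℝ × F →L[ℝ] E) = L₀ := ContinuousLinearMap.ext fun r => rfl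
  rw [hLeq]
  exact hΛs

/-- **Openness of the family for a complete set of first integrals**: `dim E = dim F + 1`, `H`
smooth, a smooth section `σ` of `H` on the open set `J`, and non-vanishing velocity along the
orbits through `σ(J)`. [cite: LeeSmoothManifolds2013, Thm. C.34] -/
theorem isOpen_flowSaturation_of_finrank [FiniteDimensional ℝ E] [FiniteDimensional ℝ F]
    (hEF : Module.finrank ℝ E = Module.finrank ℝ F + 1)
    {θ : ℝ × E → E} (hθ : ContDiff ℝ ∞ θ) {H : E → F} (hHs : ContDiff ℝ ∞ H)
    (hH : ∀ t x, H (θ (t, x)) = H x)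
    {σ : F → E} (hσ : ContDiff ℝ ∞ σ) {J : Set F} (hJ : IsOpen J) (hHσ : ∀ s ∈ J, H (σ s) = s)
    (hvel : ∀ u : ℝ, ∀ s ∈ J, ∃ v : E, v ≠ 0 ∧ HasDerivAt (fun t => θ (t, σ s)) v u) :
    IsOpen (flowSaturation θ σ J) := by
  refine isOpen_flowSaturation hJ fun u s hs => ?_
  obtain ⟨v, hv0, hv⟩ := hvel u s hs
  have hHσ' : ∀ᶠ s' in 𝓝 s, H (σ s') = s' := by
    filter_upwards [hJ.mem_nhds hs] with s' hs' using hHσ s' hs'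
  exact exists_equiv_hasStrictFDerivAt_of_finrank hEF hθ hHs hH hσ hHσ' u hv hv0

/-- **Planar openness of the family**: `dim E = 2`, one smooth first integral `H : E → ℝ`.
[cite: LeeSmoothManifolds2013, Thm. C.34] -/
theorem isOpen_flowSaturation_of_finrank_eq_two [FiniteDimensional ℝ E]
    (hE : Module.finrank ℝ E = 2)
    {θ : ℝ × E → E} (hθ : ContDiff ℝ ∞ θ) {H : E → ℝ} (hHs : ContDiff ℝ ∞ H)
    (hH : ∀ t x, H (θ (t, x)) = H x)
    {σ : ℝ → E} (hσ : ContDiff ℝ ∞ σ) {J : Set ℝ} (hJ : IsOpen J) (hHσ : ∀ s ∈ J, H (σ s) = s)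
    (hvel : ∀ u : ℝ, ∀ s ∈ J, ∃ v : E, v ≠ 0 ∧ HasDerivAt (fun t => θ (t, σ s)) v u) :
    IsOpen (flowSaturation θ σ J) :=
  isOpen_flowSaturation_of_finrank (by rw [hE, Module.finrank_self]) hθ hHs hH hσ hJ hHσ hvel

end Open

/-! ### §4b The period function is smooth on a whole neighbourhood -/

section PeriodOn

variable {E : Type*} [NormedAddCommGroup E] [NormedSpace ℝ E]
  {F : Type*} [NormedAddCommGroup F] [NormedSpace ℝ F] [CompleteSpace F]

/-- **Smooth period function on a neighbourhood** (strengthening of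
`exists_contDiffAt_period`: the germ is smooth on an open set, not just at `s₀`).  The local
inverse of `Λ(t, s) = θ(t, σ s)` is smooth on the whole of a (shrunk) target
(`Literature.Geometry.Manifold.contDiffOn_symm_of_forall_hasFDerivAt_equiv`, invertibility of the
differential being an open condition, `ContinuousLinearEquiv.isOpen`), and the period is read off
its first component. [cite: LeeSmoothManifolds2013, Thm. C.34] -/
theorem exists_contDiffOn_period {θ : ℝ × E → E} (hθ : ContDiff ℝ ∞ θ)
    {H : E → F} (hH : ∀ t x, H (θ (t, x)) = H x)
    {σ : F → E} (hσ : ContDiff ℝ ∞ σ) {J : Set F} (hJ : IsOpen J) {s₀ : F} (hs₀ : s₀ ∈ J)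
    (hHσ : ∀ s ∈ J, H (σ s) = s) {T₀ : ℝ} (hT : θ (T₀, σ s₀) = σ s₀)
    {L : (ℝ × F) ≃L[ℝ] E}
    (hΛ : HasFDerivAt (fun p : ℝ × F => θ (p.1, σ p.2)) (L : ℝ × F →L[ℝ] E) (T₀, s₀)) :
    ∃ (P : F → ℝ) (S : Set F), IsOpen S ∧ s₀ ∈ S ∧ S ⊆ J ∧ ContDiffOn ℝ ∞ P S ∧ P s₀ = T₀ ∧
      ∀ s ∈ S, θ (P s, σ s) = σ s := by
  set Λ : ℝ × F → E := fun p => θ (p.1, σ p.2) with hΛdef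
  have hΛc : ContDiff ℝ ∞ Λ := hθ.comp (contDiff_fst.prodMk (hσ.comp contDiff_snd))
  have hΛat : ContDiffAt ℝ ∞ Λ (T₀, s₀) := hΛc.contDiffAt
  have hn : (∞ : WithTop ℕ∞) ≠ 0 := by simp
  have hpt : Λ (T₀, s₀) = σ s₀ := hT
  -- the local homeomorphism of the inverse function theorem, shrunk to where `DΛ` is invertible
  -- and the parameter lies in `J`
  set Ψ₀ := hΛat.toOpenPartialHomeomorph Λ hΛ hn with hΨ₀
  have hΨ₀src : (T₀, s₀) ∈ Ψ₀.source := hΛat.mem_toOpenPartialHomeomorph_source hΛ hn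
  have hcontF : Continuous (fderiv ℝ Λ) := hΛc.continuous_fderiv (by simp)
  set W : Set (ℝ × F) := (fderiv ℝ Λ) ⁻¹' (range ((↑) : ((ℝ × F) ≃L[ℝ] E) → (ℝ × F) →L[ℝ] E)) ∩
    (univ ×ˢ J) with hW
  have hWo : IsOpen W := (ContinuousLinearEquiv.isOpen.preimage hcontF).inter (isOpen_univ.prod hJ)
  have hW0 : (T₀, s₀) ∈ W := ⟨⟨L, hΛ.fderiv.symm⟩, mem_univ _, hs₀⟩
  set Ψ := Ψ₀.restrOpen W hWo with hΨ
  have hΨsrc : Ψ.source = Ψ₀.source ∩ W := Ψ₀.restrOpen_source W hWo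
  have hΨcoe : ∀ p, Ψ p = Λ p := fun p => rfl
  have h0src : (T₀, s₀) ∈ Ψ.source := by rw [hΨsrc]; exact ⟨hΨ₀src, hW0⟩
  -- the inverse is smooth on the whole target
  have hsymm : ContDiffOn ℝ ∞ Ψ.symm Ψ.target := by
    refine contDiffOn_symm_of_forall_hasFDerivAt_equiv Ψ (g := Λ) (fun p _ => hΨcoe p) hn
      (fun a _ => hΛc.contDiffAt) fun a ha => ?_
    rw [hΨsrc] at ha
    obtain ⟨e, he⟩ := ha.2.1
    exact ⟨e, he ▸ ((hΛc.differentiable (by simp)) a).hasFDerivAt⟩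
  -- the good parameters
  set S : Set F := (σ ⁻¹' Ψ.target) ∩ J with hS
  have hSo : IsOpen S := (Ψ.open_target.preimage hσ.continuous).inter hJ
  have hσs₀ : σ s₀ = Ψ (T₀, s₀) := by rw [hΨcoe, hpt]
  have hs₀S : s₀ ∈ S := ⟨by rw [mem_preimage, hσs₀]; exact Ψ.map_source h0src, hs₀⟩
  refine ⟨fun s => (Ψ.symm (σ s)).1, S, hSo, hs₀S, inter_subset_right, ?_, ?_, ?_⟩
  · exact contDiff_fst.comp_contDiffOn (hsymm.comp hσ.contDiffOn fun s hs => hs.1)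
  · show (Ψ.symm (σ s₀)).1 = T₀
    rw [hσs₀, Ψ.left_inv h0src]
  · intro s hs
    have hy : σ s ∈ Ψ.target := hs.1
    have hp : Ψ.symm (σ s) ∈ Ψ.source := Ψ.map_target hy
    have hright : Λ (Ψ.symm (σ s)) = σ s := by rw [← hΨcoe]; exact Ψ.right_inv hy
    have hp2 : (Ψ.symm (σ s)).2 ∈ J := by
      rw [hΨsrc] at hp
      exact hp.2.2.2
    have hS2 : (Ψ.symm (σ s)).2 = s := by
      have h := congrArg H hright
      change H (θ ((Ψ.symm (σ s)).1, σ (Ψ.symm (σ s)).2)) = H (σ s) at h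
      rw [hH, hHσ _ hp2, hHσ s hs.2] at h
      exact h
    have h' : θ ((Ψ.symm (σ s)).1, σ (Ψ.symm (σ s)).2) = σ s := hright
    rw [hS2] at h'
    exact h'

end PeriodOn

/-! ### §5 The cut-off time function of the twist is smooth on the whole space -/

section TwistTimeAlgebra

variable {E : Type*} {F : Type*}

/-- **The time function of the twist along the family**: `μ(H x) · P(H x)` on the saturation of the
family, `0` elsewhere (`μ` a bump in the first integrals, `P` the period function).
[cite: FarbMargalit2012, §3.1.1] -/
def twistTime (θ : ℝ × E → E) (σ : F → E) (J : Set F) (H : E → F) (μ P : F → ℝ) : E → ℝ :=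
  (flowSaturation θ σ J).indicator fun x => μ (H x) * P (H x)

/-- On the family the time function is the bump times the period. [folklore] -/
theorem twistTime_of_mem {θ : ℝ × E → E} {σ : F → E} {J : Set F} {H : E → F} {μ P : F → ℝ} {x : E}
    (hx : x ∈ flowSaturation θ σ J) : twistTime θ σ J H μ P x = μ (H x) * P (H x) :=
  indicator_of_mem hx _

/-- Off the family the time function vanishes. [folklore] -/
theorem twistTime_of_not_mem {θ : ℝ × E → E} {σ : F → E} {J : Set F} {H : E → F} {μ P : F → ℝ}
    {x : E} (hx : x ∉ flowSaturation θ σ J) : twistTime θ σ J H μ P x = 0 :=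
  indicator_of_notMem hx _

/-- **The time function is constant along the orbits** (the family is invariant and `H` is a first
integral). [folklore] -/
theorem twistTime_invariant {θ : ℝ × E → E} (h0 : ∀ x, θ (0, x) = x)
    (hadd : ∀ t s x, θ (t, θ (s, x)) = θ (t + s, x)) {σ : F → E} {J : Set F}
    {H : E → F} (hH : ∀ t x, H (θ (t, x)) = H x) (μ P : F → ℝ) (t : ℝ) (x : E) :
    twistTime θ σ J H μ P (θ (t, x)) = twistTime θ σ J H μ P x := by
  by_cases hx : x ∈ flowSaturation θ σ J
  · rw [twistTime_of_mem hx, twistTime_of_mem (flowSaturation_invariant hadd σ J t hx), hH]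
  · have hx' : θ (t, x) ∉ flowSaturation θ σ J := by
      intro h
      have h' := flowSaturation_invariant hadd σ J (-t) h
      rw [hadd, neg_add_cancel, h0] at h'
      exact hx h'
    rw [twistTime_of_not_mem hx, twistTime_of_not_mem hx']

/-- **The twist time is a period off the active zone**: `θ(τ x, x) = x` whenever `x` is not on the
family, or the bump is `1` at `x` (there the time is a full period). [cite: FarbMargalit2012, §3.1.1] -/
theorem apply_twistTime_eq_self {θ : ℝ × E → E} (h0 : ∀ x, θ (0, x) = x)
    (hadd : ∀ t s x, θ (t, θ (s, x)) = θ (t + s, x)) {σ : F → E} {J : Set F}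
    {H : E → F} (hH : ∀ t x, H (θ (t, x)) = H x) {μ P : F → ℝ}
    (hHσ : ∀ s ∈ J, H (σ s) = s) (hP : ∀ s ∈ J, θ (P s, σ s) = σ s) {x : E}
    (hx : x ∉ flowSaturation θ σ J ∨ μ (H x) = 1) :
    θ (twistTime θ σ J H μ P x, x) = x := by
  by_cases hmem : x ∈ flowSaturation θ σ J
  · have hμ : μ (H x) = 1 := hx.resolve_left (not_not.2 hmem)
    rw [twistTime_of_mem hmem, hμ, one_mul]
    exact apply_period_of_mem_flowSaturation hadd hH hHσ hP hmem
  · rw [twistTime_of_not_mem hmem, h0]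

end TwistTimeAlgebra

section TwistTime

variable {E : Type*} [NormedAddCommGroup E] [NormedSpace ℝ E]
  {F : Type*} [NormedAddCommGroup F] [NormedSpace ℝ F]

/-- **The cut-off time function is smooth on all of `E`** when the family is open and closed in
`H⁻¹(J)`, the bump `μ` is smooth and vanishes off a closed set `C ⊆ J`, `H` is smooth, and the
period function is smooth on `J` (open).  On the family it is a composite of smooth maps; off the
family it vanishes identically near every point: near points with `H x ∉ C` because `μ ∘ H = 0`
there, and near the remaining points because they are not limit points of the family.
[cite: FarbMargalit2012, §3.1.1] [cite: LeeSmoothManifolds2013, Thm. 9.12] -/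
theorem contDiff_twistTime {θ : ℝ × E → E} {σ : F → E} {J : Set F} (hJ : IsOpen J)
    {H : E → F} (hHs : ContDiff ℝ ∞ H) (hHσ : ∀ s ∈ J, H (σ s) = s)
    (hH : ∀ t x, H (θ (t, x)) = H x)
    (hopen : IsOpen (flowSaturation θ σ J))
    (hclosed : ∀ x ∈ closure (flowSaturation θ σ J), H x ∈ J → x ∈ flowSaturation θ σ J)
    {μ : F → ℝ} (hμ : ContDiff ℝ ∞ μ) {C : Set F} (hC : IsClosed C) (hCJ : C ⊆ J)
    (hμC : ∀ s ∉ C, μ s = 0) {P : F → ℝ} (hPs : ContDiffOn ℝ ∞ P J) :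
    ContDiff ℝ ∞ (twistTime θ σ J H μ P) := by
  rw [contDiff_iff_contDiffAt]
  intro x
  by_cases hx : x ∈ flowSaturation θ σ J
  · -- on the open family: a composite of smooth maps
    obtain ⟨u, s, hs, rfl⟩ := mem_flowSaturation_iff.1 hx
    have hHx : H (θ (u, σ s)) = s := by rw [hH, hHσ s hs]
    have hPat : ContDiffAt ℝ ∞ P (H (θ (u, σ s))) := by
      rw [hHx]; exact hPs.contDiffAt (hJ.mem_nhds hs)
    have hsmooth : ContDiffAt ℝ ∞ (fun y => μ (H y) * P (H y)) (θ (u, σ s)) :=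
      (hμ.contDiffAt.comp _ hHs.contDiffAt).mul (hPat.comp _ hHs.contDiffAt)
    refine hsmooth.congr_of_eventuallyEq ?_
    filter_upwards [hopen.mem_nhds hx] with y hy using twistTime_of_mem hy
  · -- off the family the time function vanishes near `x`
    have hzero : ∀ᶠ y in 𝓝 x, twistTime θ σ J H μ P y = 0 := by
      by_cases hHx : H x ∈ C
      · -- `H x ∈ C ⊆ J`: `x` is not a limit point of the family
        have hncl : x ∉ closure (flowSaturation θ σ J) := fun h => hx (hclosed x h (hCJ hHx))
        have hopen' : IsOpen (closure (flowSaturation θ σ J))ᶜ := isClosed_closure.isOpen_compl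
        filter_upwards [hopen'.mem_nhds hncl] with y hy
        exact twistTime_of_not_mem fun h => hy (subset_closure h)
      · -- `H x ∉ C`: nearby `μ ∘ H = 0`
        have hopen' : IsOpen (H ⁻¹' Cᶜ) := hC.isOpen_compl.preimage hHs.continuous
        filter_upwards [hopen'.mem_nhds hHx] with y hy
        by_cases hy' : y ∈ flowSaturation θ σ J
        · rw [twistTime_of_mem hy', hμC _ hy, zero_mul]
        · exact twistTime_of_not_mem hy'
    exact contDiffAt_const.congr_of_eventuallyEq hzero

end TwistTime

/-! ### §6 The Dehn twist along the family -/

section Twist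

variable {E : Type*} [NormedAddCommGroup E] [NormedSpace ℝ E] {F : Type*}

/-- A smooth map `ℝ × E → E` is `C^∞` for the product of the self-models (the form in which flows on
manifolds are stated in the tree). [folklore] -/
theorem contMDiff_prod_self_of_contDiff {θ : ℝ × E → E} (hθ : ContDiff ℝ ∞ θ) :
    ContMDiff (𝓘(ℝ, ℝ).prod 𝓘(ℝ, E)) 𝓘(ℝ, E) ∞ θ := by
  rw [← modelWithCornersSelf_prod, chartedSpaceSelf_prod]
  exact hθ.contMDiff

/-- **The Dehn twist along a smooth family of closed orbits**: the diffeomorphism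
`x ↦ θ(τ x, x)` of `E`, `τ` the cut-off time function (`twistTime`), for a smooth flow and a smooth,
invariant `τ` (`contDiff_twistTime`, `twistTime_invariant`).  Farb–Margalit's twist map of the
annulus is the case of the rotation flow of the plane. [cite: FarbMargalit2012, §3.1.1] -/
def twistDiffeomorph {θ : ℝ × E → E} (hθ : ContDiff ℝ ∞ θ) (h0 : ∀ x, θ (0, x) = x)
    (hadd : ∀ t s x, θ (t, θ (s, x)) = θ (t + s, x)) {τ : E → ℝ} (hτ : ContDiff ℝ ∞ τ)
    (hinv : ∀ t x, τ (θ (t, x)) = τ x) : E ≃ₘ⟮𝓘(ℝ, E), 𝓘(ℝ, E)⟯ E :=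
  flowReparamDiffeomorph (I := 𝓘(ℝ, E)) (contMDiff_prod_self_of_contDiff hθ) h0 hadd hτ.contMDiff hinv

/-- The twist on points. [folklore] -/
@[simp] theorem twistDiffeomorph_apply {θ : ℝ × E → E} (hθ : ContDiff ℝ ∞ θ) (h0 : ∀ x, θ (0, x) = x)
    (hadd : ∀ t s x, θ (t, θ (s, x)) = θ (t + s, x)) {τ : E → ℝ} (hτ : ContDiff ℝ ∞ τ)
    (hinv : ∀ t x, τ (θ (t, x)) = τ x) (x : E) :
    twistDiffeomorph hθ h0 hadd hτ hinv x = θ (τ x, x) := rfl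

/-- **The twist preserves every first integral of the flow** (for the level function of a regular
sublevel set this is what makes it restrict to the boundary surface). [folklore] -/
theorem apply_twistDiffeomorph_of_invariant {θ : ℝ × E → E} (hθ : ContDiff ℝ ∞ θ)
    (h0 : ∀ x, θ (0, x) = x) (hadd : ∀ t s x, θ (t, θ (s, x)) = θ (t + s, x)) {τ : E → ℝ}
    (hτ : ContDiff ℝ ∞ τ) (hinv : ∀ t x, τ (θ (t, x)) = τ x) {β : Type*} {G : E → β}
    (hG : ∀ t x, G (θ (t, x)) = G x) (x : E) : G (twistDiffeomorph hθ h0 hadd hτ hinv x) = G x :=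
  hG _ _

/-- **The twist along the family is the identity off the family and where the bump is `1`.**
[cite: FarbMargalit2012, §3.1.1] -/
theorem twistDiffeomorph_twistTime_apply_eq_self {θ : ℝ × E → E} (hθ : ContDiff ℝ ∞ θ)
    (h0 : ∀ x, θ (0, x) = x) (hadd : ∀ t s x, θ (t, θ (s, x)) = θ (t + s, x))
    {σ : F → E} {J : Set F} {H : E → F} (hH : ∀ t x, H (θ (t, x)) = H x) {μ P : F → ℝ}
    (hHσ : ∀ s ∈ J, H (σ s) = s) (hP : ∀ s ∈ J, θ (P s, σ s) = σ s)
    (hτ : ContDiff ℝ ∞ (twistTime θ σ J H μ P)) {x : E}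
    (hx : x ∉ flowSaturation θ σ J ∨ μ (H x) = 1) :
    twistDiffeomorph hθ h0 hadd hτ (twistTime_invariant h0 hadd hH μ P) x = x :=
  apply_twistTime_eq_self h0 hadd hH hHσ hP hx

end Twist


/-! ### §7 Assembly: the twist package near a non-degenerate closed orbit -/

section Package

variable {E : Type*} [NormedAddCommGroup E] [NormedSpace ℝ E] [FiniteDimensional ℝ E]
  {F : Type*} [NormedAddCommGroup F] [NormedSpace ℝ F] [FiniteDimensional ℝ F] [CompleteSpace F]

/-- **The twist package near a non-degenerate closed orbit.**  Let `θ` be a smooth global flow on a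
finite-dimensional space `E` with a complete set of smooth first integrals `H : E → F`
(`dim E = dim F + 1`), `σ` a smooth section of `H` over the open set `J`, through a closed orbit
`θ(T₀, σ s₀) = σ s₀` of positive period, and suppose the velocity does not vanish along the orbits
through `σ(J)`.  Then on some open `S ∋ s₀`, `S ⊆ J`, there is a smooth positive period function
`P` (`θ(P s, σ s) = σ s`), the family of closed orbits over `S` (its saturation) is open, and it is
closed in `H⁻¹(S)` — exactly the hypotheses of `contDiff_twistTime`, so that for every smooth bump
`μ` in the first integrals vanishing off a closed subset of `S` the Dehn twist
`twistDiffeomorph` along the family is defined (`contDiff_twistTime`, `twistTime_invariant`), is a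
diffeomorphism of `E` preserving `H`, and is the identity off the family and where `μ ∘ H = 1`.
[cite: FarbMargalit2012, §3.1.1] [cite: LeeSmoothManifolds2013, Thm. 9.12 and Thm. C.34] -/
theorem exists_period_package (hEF : Module.finrank ℝ E = Module.finrank ℝ F + 1)
    {θ : ℝ × E → E} (hθ : ContDiff ℝ ∞ θ) (h0 : ∀ x, θ (0, x) = x)
    (hadd : ∀ t s x, θ (t, θ (s, x)) = θ (t + s, x))
    {H : E → F} (hHs : ContDiff ℝ ∞ H) (hH : ∀ t x, H (θ (t, x)) = H x)
    {σ : F → E} (hσ : ContDiff ℝ ∞ σ) {J : Set F} (hJ : IsOpen J) {s₀ : F} (hs₀ : s₀ ∈ J)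
    (hHσ : ∀ s ∈ J, H (σ s) = s) {T₀ : ℝ} (hT₀ : 0 < T₀) (hT : θ (T₀, σ s₀) = σ s₀)
    (hvel : ∀ u : ℝ, ∀ s ∈ J, ∃ v : E, v ≠ 0 ∧ HasDerivAt (fun t => θ (t, σ s)) v u) :
    ∃ (P : F → ℝ) (S : Set F), IsOpen S ∧ s₀ ∈ S ∧ S ⊆ J ∧ ContDiffOn ℝ ∞ P S ∧ P s₀ = T₀ ∧
      (∀ s ∈ S, 0 < P s) ∧ (∀ s ∈ S, H (σ s) = s) ∧ (∀ s ∈ S, θ (P s, σ s) = σ s) ∧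
      IsOpen (flowSaturation θ σ S) ∧
      ∀ x ∈ closure (flowSaturation θ σ S), H x ∈ S → x ∈ flowSaturation θ σ S := by
  -- non-degeneracy at `(T₀, s₀)` and the smooth period on a neighbourhood
  obtain ⟨v, hv0, hv⟩ := hvel T₀ s₀ hs₀
  have hHσ' : ∀ᶠ s' in 𝓝 s₀, H (σ s') = s' := by
    filter_upwards [hJ.mem_nhds hs₀] with s' hs' using hHσ s' hs'
  obtain ⟨L, hL⟩ := exists_equiv_hasStrictFDerivAt_of_finrank hEF hθ hHs hH hσ hHσ' T₀ hv hv0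
  obtain ⟨P, S₁, hS₁o, hs₀S₁, hS₁J, hPs, hP0, hP⟩ :=
    exists_contDiffOn_period hθ hH hσ hJ hs₀ hHσ hT hL.hasFDerivAt
  -- shrink to positive periods
  set S : Set F := S₁ ∩ P ⁻¹' Ioi 0 with hSdef
  have hSo : IsOpen S := hPs.continuousOn.isOpen_inter_preimage hS₁o isOpen_Ioi
  have hs₀S : s₀ ∈ S := ⟨hs₀S₁, by rw [mem_preimage, hP0]; exact hT₀⟩
  have hSS₁ : S ⊆ S₁ := inter_subset_left
  have hSJ : S ⊆ J := hSS₁.trans hS₁J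
  have hHσS : ∀ s ∈ S, H (σ s) = s := fun s hs => hHσ s (hSJ hs)
  have hPS : ∀ s ∈ S, θ (P s, σ s) = σ s := fun s hs => hP s (hSS₁ hs)
  have hPpos : ∀ s ∈ S, 0 < P s := fun s hs => hs.2
  refine ⟨P, S, hSo, hs₀S, hSJ, hPs.mono hSS₁, hP0, hPpos, hHσS, hPS, ?_, ?_⟩
  · exact isOpen_flowSaturation_of_finrank hEF hθ hHs hH hσ hSo hHσS
      fun u s hs => hvel u s (hSJ hs)
  · intro x hx hxS
    exact mem_flowSaturation_of_mem_closure hθ.continuous h0 hadd hHs.continuous hH hσ.continuous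
      hHσS (hPs.mono hSS₁).continuousOn hPpos hPS hx (hSo.mem_nhds hxS)

/-- **The Dehn twist near a non-degenerate closed orbit exists**, in the form consumed by the
boundary-restriction mechanism of regular sublevel sets: under the hypotheses of
`exists_period_package`, for every smooth bump `μ` in the first integrals supported in a closed
subset `C` of the good parameter set `S`, there is a diffeomorphism `T` of `E` with
`H ∘ T = H`, `T = id` off the family over `S`, and `T x = θ(μ(H x) · P(H x), x)` on the family (so
`T = id` where `μ ∘ H = 1`: a full turn). [cite: FarbMargalit2012, §3.1.1] -/
theorem exists_twistDiffeomorph (hEF : Module.finrank ℝ E = Module.finrank ℝ F + 1)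
    {θ : ℝ × E → E} (hθ : ContDiff ℝ ∞ θ) (h0 : ∀ x, θ (0, x) = x)
    (hadd : ∀ t s x, θ (t, θ (s, x)) = θ (t + s, x))
    {H : E → F} (hHs : ContDiff ℝ ∞ H) (hH : ∀ t x, H (θ (t, x)) = H x)
    {σ : F → E} (hσ : ContDiff ℝ ∞ σ) {J : Set F} (hJ : IsOpen J) {s₀ : F} (hs₀ : s₀ ∈ J)
    (hHσ : ∀ s ∈ J, H (σ s) = s) {T₀ : ℝ} (hT₀ : 0 < T₀) (hT : θ (T₀, σ s₀) = σ s₀)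
    (hvel : ∀ u : ℝ, ∀ s ∈ J, ∃ v : E, v ≠ 0 ∧ HasDerivAt (fun t => θ (t, σ s)) v u) :
    ∃ (P : F → ℝ) (S : Set F), IsOpen S ∧ s₀ ∈ S ∧ S ⊆ J ∧ P s₀ = T₀ ∧
      (∀ s ∈ S, θ (P s, σ s) = σ s) ∧
      ∀ (μ : F → ℝ), ContDiff ℝ ∞ μ → ∀ C : Set F, IsClosed C → C ⊆ S → (∀ s ∉ C, μ s = 0) →
        ∃ T : E ≃ₘ⟮𝓘(ℝ, E), 𝓘(ℝ, E)⟯ E,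
          (∀ x, H (T x) = H x) ∧
          (∀ x, x ∉ flowSaturation θ σ S → T x = x) ∧
          (∀ x ∈ flowSaturation θ σ S, T x = θ (μ (H x) * P (H x), x)) ∧
          ∀ x, μ (H x) = 1 → T x = x := by
  obtain ⟨P, S, hSo, hs₀S, hSJ, hPs, hP0, hPpos, hHσS, hPS, hopen, hclosed⟩ :=
    exists_period_package hEF hθ h0 hadd hHs hH hσ hJ hs₀ hHσ hT₀ hT hvel
  refine ⟨P, S, hSo, hs₀S, hSJ, hP0, hPS, fun μ hμ C hC hCS hμC => ?_⟩
  have hτ : ContDiff ℝ ∞ (twistTime θ σ S H μ P) :=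
    contDiff_twistTime hSo hHs hHσS hH hopen hclosed hμ hC hCS hμC hPs
  refine ⟨twistDiffeomorph hθ h0 hadd hτ (twistTime_invariant h0 hadd hH μ P), fun x => hH _ _,
    fun x hx => ?_, fun x hx => ?_, fun x hx => ?_⟩
  · exact twistDiffeomorph_twistTime_apply_eq_self hθ h0 hadd hH hHσS hPS hτ (Or.inl hx)
  · rw [twistDiffeomorph_apply, twistTime_of_mem hx]
  · exact twistDiffeomorph_twistTime_apply_eq_self hθ h0 hadd hH hHσS hPS hτ (Or.inr hx)

end Package

/-! ### The minimal period of a closed orbit -/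

section MinimalPeriod

variable {E : Type*} [TopologicalSpace E] [T2Space E]

/-- **The minimal period of a closed orbit.**  For a continuous flow `θ` (group law) and a point
`x` with SOME positive period which is not a rest point, the periods of `x` are exactly the
integer multiples of a least positive period `T₀` (the set of periods is a closed additive
subgroup of `ℝ`, not dense since `x` moves, hence cyclic — `AddSubgroup.dense_or_cyclic`).
[folklore] -/
theorem exists_minimal_period {θ : ℝ × E → E} (hθ : Continuous θ) (h0 : ∀ x, θ (0, x) = x)
    (hadd : ∀ t s x, θ (t, θ (s, x)) = θ (t + s, x)) {x : E} {T : ℝ} (hT : 0 < T)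
    (hTx : θ (T, x) = x) (hmove : ∃ t, θ (t, x) ≠ x) :
    ∃ T₀ : ℝ, 0 < T₀ ∧ θ (T₀, x) = x ∧ ∀ t, θ (t, x) = x ↔ ∃ n : ℤ, t = n * T₀ := by
  -- the subgroup of periods
  let S : AddSubgroup ℝ :=
    { carrier := {t | θ (t, x) = x}
      add_mem' := fun {a b} ha hb => by
        show θ (a + b, x) = x
        rw [← hadd, hb, ha]
      zero_mem' := h0 x
      neg_mem' := fun {a} ha => by
        show θ (-a, x) = x
        conv_lhs => rw [← ha]
        rw [hadd, neg_add_cancel, h0] }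
  have hSclosed : IsClosed (S : Set ℝ) :=
    isClosed_eq (hθ.comp (continuous_id.prodMk continuous_const)) continuous_const
  have hTS : T ∈ S := hTx
  rcases AddSubgroup.dense_or_cyclic S with hdense | ⟨a, ha⟩
  · -- dense and closed: every real number is a period, so `x` is a rest point
    exfalso
    obtain ⟨t, ht⟩ := hmove
    have : t ∈ (S : Set ℝ) := by
      rw [← hSclosed.closure_eq, hdense.closure_eq]; exact mem_univ t
    exact ht this
  · have ha0 : a ≠ 0 := by
      rintro rfl
      have : T ∈ AddSubgroup.closure ({0} : Set ℝ) := ha ▸ hTS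
      rw [AddSubgroup.mem_closure_singleton] at this
      obtain ⟨n, hn⟩ := this
      rw [smul_zero] at hn
      exact hT.ne' hn.symm
    refine ⟨|a|, abs_pos.2 ha0, ?_, fun t => ?_⟩
    · have hamem : a ∈ S := by
        rw [ha, AddSubgroup.mem_closure_singleton]; exact ⟨1, one_smul _ _⟩
      rcases abs_choice a with h | h <;> rw [h]
      · exact hamem
      · exact S.neg_mem hamem
    · change t ∈ S ↔ _
      rw [ha, AddSubgroup.mem_closure_singleton]
      constructor
      · rintro ⟨n, rfl⟩
        rcases abs_choice a with h | h
        · exact ⟨n, by rw [h, zsmul_eq_mul]⟩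
        · exact ⟨-n, by rw [h, zsmul_eq_mul]; push_cast; ring⟩
      · rintro ⟨n, rfl⟩
        rcases abs_choice a with h | h
        · exact ⟨n, by rw [h, zsmul_eq_mul]⟩
        · exact ⟨-n, by rw [h, zsmul_eq_mul]; push_cast; ring⟩

end MinimalPeriod

end Literature.Geometry.Manifold

end
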